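import Summits.ABC.IUTFork.Thm311RealDegreeFull
import Summits.ABC.IUTFork.LDHPerPrimeReadingWitness
import Literature.IUT.LogThetaLattice.StripFrameWitness
import HarnessLib

/-!
# [IUTchIII] Theorem 3.11 AS TYPED is Θ-PILOT-FREE at a real instantiation — a CLOSED kernel certificate

PROOF-ONLY audit companion (D-0012; no definitions, no instances) of abc-iut-c312-1's `Thm311RealDegreeFull`
(p418191; `Thm311.Real.full_statement_Pr_LGP`: the cell's premise of record `Thm311.FullSituation.Statement`
— [IUTchIII] Thm. 3.11 (i) ∧ (ii) ∧ (iii) as typed, kurims manuscript `paper:url-4b091feeb646` pp. 153–158 —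
HOLDS OUTRIGHT at the probability-weighted real instantiation, for every choice of its explicit binders).
Seat abc-iut-w5-d236 (RQ7 second reader of p418191); TAKES NO SIDE on [IUTchIII] Cor. 3.12.

What this file adds is CLOSEDNESS: every binder of that theorem is instantiated by an object ALREADY IN THE TREE
over the number field `ℚ` — the pilot datum `PilotData.deepAt ℚ 2 5 _ _ 1 _` of abc-iut-w5-d157 (`j_E = 2^{-10}`,
bad places `V(ℚ)_2`, `l = 5`), empty archimedean sub-structures / global moduli / regions, the zero action,
`2l`-th roots `0` and torsion profiles `1` at the bad places, and for the (iii)-objects the L6 WITNESS glue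
`Literature.IUT.LogThetaLattice.Witness.twoGlue` / `twoLattice` of abc-iut-L6-t3's `StripFrameWitness` with the
`∞κ` functor `𝟭` — so that the only datum left free is the assignment `thetaDiv₀ n m` of Θ-pilot lgp-divisors,
over which the statement is UNIVERSAL:

* `Real.exists_fullSituation_statement_of_thetaDiv` — for EVERY `thetaDiv₀ : ℤ → ℤ → LgpDivisor ℚ ℓ⋆` there is a
  full situation of Theorem 3.11 over these real carriers whose typed Theorem 3.11 HOLDS and whose Θ-pilot
  object at `(n, m)`, read through the Kummer isomorphism `^{n,m}C^⊩_LGP ⥲ C^⊩_LGP(^{n,∘}HT)` of (ii) (c), IS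
  `thetaDiv₀ n m` (abc-iut-c312-5's `Column.ofDivisors_kumLGP_thetaPilot`, `rfl`);
* `Real.fullSituation_statement_thetaPilot_indep` — hence two such situations that differ ONLY in their Θ-pilot
  objects both satisfy the typed Theorem 3.11: at this instantiation the premise of record places no
  constraint on the Θ-pilot, in particular none on its degree.

HONEST FRAMING (ADJUDICATION-SPEC §3 (b); cell rule "vacuity-audit every fork-level hypothesis"): a measurement
of the TYPING at real carriers, consistent with Team A's `Thm311ToCor312Checks.independence` and the (G3)
countermodels (`Cor312Vol.GapWitness.thm311_bridgeHyps_not_imp_statement`); it says nothing about the truth of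
[IUTchIII] Thm. 3.11 or Cor. 3.12 — in the author's text the content of Theorem 3.11 sits in the CONSTRUCTIONS
(multiradial representation, log-Kummer correspondence) that the strictified typing renders as identifications
(LANA Rem. 8.2.1; Scholze–Stix 2018 §2.2). [claim: Mochizuki2012, status: disputed]
Deliberately NOT here: any definition; any edit to c312-1's / c312-5's / w5-d157's / L6-t3's files; any judgement.
typed ≠ proved; instantiated ≠ endorsed.
-/

noncomputable section

namespace Summit.ABC.IUTFork.Thm311.Real

open CategoryTheory Literature.IUT.LogThetaLattice Literature.IUT.LogThetaLattice.Witness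
  Literature.IUT.LogVolume

/-- **The typed Theorem 3.11 is Θ-pilot-free at a real instantiation (closed certificate).** Over `ℚ`, with the
tree's pilot datum `PilotData.deepAt ℚ 2 5 _ _ 1 _`, the probability-weighted verbatim container, the analytic
logarithms, the LGP splitting monoids for `qroot := 0`, `ζ := 1`, empty `archSub`/`Mmod`/`region`, the zero
action, and the (iii)-objects glued from the L6 witness glue `twoGlue`/`twoLattice` with `FM := 𝟭`: for EVERY
assignment `thetaDiv₀` of Θ-pilot lgp-divisors there is a `Thm311.FullSituation` whose `Statement`
([IUTchIII] Thm. 3.11 (i) ∧ (ii) ∧ (iii) as typed) HOLDS and whose Θ-pilot object at `(n, m)`, read in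
`C^⊩_LGP(^{n,∘}HT)` through the Kummer isomorphism of (ii) (c), is `thetaDiv₀ n m`.
[claim: Mochizuki2012, status: disputed] -/
theorem exists_fullSituation_statement_of_thetaDiv
    (thetaDiv₀ : ℤ → ℤ →
      LgpDivisor ℚ (thetaIndex (PilotData.deepAt ℚ 2 5 Nat.prime_five le_rfl 1 one_pos)).lstar) :
    ∃ Sit : Summit.ABC.IUTFork.Thm311.FullSituation
        (thetaIndex (PilotData.deepAt ℚ 2 5 Nat.prime_five le_rfl 1 one_pos)),
      Sit.Statement ∧ ∀ n m : ℤ, HEq ((Sit.col n).kumLGP m ((Sit.col n).thetaPilot m)) (thetaDiv₀ n m) :=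
  ⟨_, full_statement_Pr_LGP (PilotData.deepAt ℚ 2 5 Nat.prime_five le_rfl 1 one_pos) (fun _ _ => ∅)
      (fun _ _ _ => 0) (fun _ => ∅) (fun _ _ _ _ => ∅) thetaDiv₀ twoGlue twoLattice (𝟭 (Core twoFrame.DHT))
      (fun _ => 0) (fun _ _ => 1), fun _ _ => HEq.rfl⟩

/-- **Hence the premise of record does not constrain the Θ-pilot**: for ANY two assignments `t`, `t'` of
Θ-pilot lgp-divisors there are full situations over the same real carriers, with Θ-pilot objects `t`, resp.
`t'`, BOTH satisfying the typed Theorem 3.11. [claim: Mochizuki2012, status: disputed] -/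
theorem fullSituation_statement_thetaPilot_indep
    (t t' : ℤ → ℤ →
      LgpDivisor ℚ (thetaIndex (PilotData.deepAt ℚ 2 5 Nat.prime_five le_rfl 1 one_pos)).lstar) :
    (∃ Sit : Summit.ABC.IUTFork.Thm311.FullSituation
        (thetaIndex (PilotData.deepAt ℚ 2 5 Nat.prime_five le_rfl 1 one_pos)),
      Sit.Statement ∧ ∀ n m : ℤ, HEq ((Sit.col n).kumLGP m ((Sit.col n).thetaPilot m)) (t n m)) ∧
    ∃ Sit : Summit.ABC.IUTFork.Thm311.FullSituation
        (thetaIndex (PilotData.deepAt ℚ 2 5 Nat.prime_five le_rfl 1 one_pos)),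
      Sit.Statement ∧ ∀ n m : ℤ, HEq ((Sit.col n).kumLGP m ((Sit.col n).thetaPilot m)) (t' n m) :=
  ⟨exists_fullSituation_statement_of_thetaDiv t, exists_fullSituation_statement_of_thetaDiv t'⟩

/-- **Closed existence form**: there EXIST a number field, a pilot datum and a full situation of Theorem 3.11 over
its real carriers at which the typed Theorem 3.11 holds — with every (iii)-object, glue and column instantiated
by tree objects (no free binder). [claim: Mochizuki2012, status: disputed] -/
theorem exists_real_fullSituation_statement :
    ∃ (X : PilotData ℚ) (Sit : Summit.ABC.IUTFork.Thm311.FullSituation (thetaIndex X)), Sit.Statement :=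
  ⟨_, (exists_fullSituation_statement_of_thetaDiv fun _ _ => 0).choose,
    (exists_fullSituation_statement_of_thetaDiv fun _ _ => 0).choose_spec.1⟩

end Summit.ABC.IUTFork.Thm311.Real

end
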